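import Summits.BirchSwinnertonDyer.BirchSwinnertonDyer.Theorems.ByReductionTypeAtTwoAdditiveOverK
import Literature.NumberTheory.EllipticCurves.NonvanishingTwistsPrescribedAtTwo
import Literature.NumberTheory.QuadraticFields.FundamentalDiscriminant
import HarnessLib

/-!
# Route `ByReductionTypeAtTwo` (rung K4), crux `AdditiveRankZeroAtTwo` (item
# stmt-BirchSwinnertonDyer-19098), DEFECT-`≥ 3` sub-class: the INERT twist supply at `2` is PRINT —
# for every `E/ℚ` a quadratic field `K` with `2` INERT (`d_K ≡ 5 (mod 8)`) and `L(E^{(d_K)}, 1) ≠ 0`,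
# from Murty–Murty 1997, Ch. 6 (seat `bsd-2adic-addL2x`, GEN 0)

HONEST FRAMING (cell `bsd-2adic`, run/shared/lean/pub/bsd-2adic/, HUMAN RULINGS D-0036/D-0074):
theorems only; ONE displayed Literature named fact (Murty–Murty, *Non-vanishing of `L`-functions and
applications*, Progress in Math. 157 (1997), Ch. 6, Thm. 1.2 with the book's deduction of Thm. 1.1:
`murtyMurty_exists_twist_ne_zero_prescribedAtTwo` — for EVERY `E/ℚ` a squarefree `D ≡ 5 (mod 8)`
(resp. `≡ 1 (mod 8)`), as large as wanted, odd bad primes split, with `L(E^{(D)}, 1) ≠ 0`; no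
root-number hypothesis); nothing else asserted; no class closed; BSD is not proved by any of this.
It DISCHARGES the binder `hTw5` (inert twist supply:
`AddTwoL2.ExistsNonvanishingTwistWith W (fun K _ _ => AddTwoL2.TwoInert K)` for every non-CM
analytic-rank-`0` curve of semistability defect `≥ 3` at `2`) of the inert pair door
`Theorems.additiveDefectAtTwo_of_inertPair` (`Theorems/ByReductionTypeAtTwoAdditiveOverK.lean`,
p422893, seat `bsd-2adic-addL2` GEN 4) — the door displayed `hTw5` as «NOT the tree's Hoffstein–Luo
fact, whose `d ≡ 1 (mod 8)` makes `2` split» — so that the defect-`≥ 3` sub-class (1 382 of the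
1 945 book230 additive-at-`2` classes: odd core `C₃` 454 + `C₆` 147, 2-power core `C₄` 18 + `Q₈`
189 + `SL₂(𝔽₃)` 574) of crux `AdditiveRankZeroAtTwo` costs exactly: PRINT {GZK, modularity, Milne
1972, Murty–Murty 1997} + the lens-L1 upper halves at the additive prime (`hU`) + the over-`K`
`2`-part for the inert field (`hGodd`, the `Δ = C₃`-equivariant descent object; WALL on the 2-power
core). PARTITION (D-0054): X5@2 ADDITIVE, defect-`≥ 3` sub-class (B1·O1; 1 382 classes) × p = 2 —
types-the-object-of (input `hTw5` of the inert pair door); closes none.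

## The construction

Murty–Murty with the class `5 (mod 8)` prescribed: a squarefree `D ≡ 5 (mod 8)` with
`L(W^{(D)}, 1) ≠ 0`. Then `D ≡ 1 (mod 4)`, `D ≠ 1`, so `D` is a fundamental discriminant and
`K := ℚ(√D)` exists with `d_K = D` (`Quadratic.exists_numberField_discr_eq`); `d_K % 8 = 5` is
`AddTwoL2.TwoInert K` verbatim, and `L(W^{(d_K)}, 1) = L(W^{(D)}, 1) ≠ 0`. No hypothesis on `W`
beyond `W.IsElliptic` is used.

## Contents

* §1 `existsNonvanishingInertTwist_of_murtyMurty` — THE INERT TWIST SUPPLY AT `2`, for every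
  elliptic `W/ℚ`; and its ∀-closed restatement `additiveInertTwistSupplyAtTwo_of_murtyMurty` in the
  binder shape `hTw5` of `Theorems.additiveDefectAtTwo_of_inertPair`.
* §2 `additiveDefectAtTwo_of_inertPair_of_murtyMurty` — the inert pair door with `hTw5` fed BY NAME
  (remaining displayed inputs: `hU`, `hGodd`); `additiveRankZeroAtTwo_of_quadratic_of_inertPair_of_murtyMurty`
  — the crux BY NAME from its quadratic part + PRINT + `hU` + `hGodd`.

References: [MurtyMurty1997] Ch. 6 Thms. 1.1–1.2 (text pp. 93–94, 96);
[Milne1972ArithmeticAV] §1 Thm. 1; [LiTianYanZhu2025] §1.3 (I) (mechanism named in `hGodd`).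
-/

set_option autoImplicit false
-- the Theorems namespace of this sub repeats the summit name by design (D-0017 nested layout)
set_option linter.dupNamespace false

noncomputable section

open scoped Classical

open WeierstrassCurve Literature.NumberTheory.EllipticCurves
  Literature.NumberTheory.EllipticCurves.Rank1Residual
  Literature.NumberTheory.EllipticCurves.Rank1Residual.Typed
  Literature.NumberTheory.QuadraticFields
  Summit.BirchSwinnertonDyer.Rank1Residual.AdditivePotMult
  Summit.BirchSwinnertonDyer.Rank1Residual.X5.AddTwoL2
  Summit.BirchSwinnertonDyer.BirchSwinnertonDyer.Theses.ByReductionTypeAtTwo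

namespace Summit.BirchSwinnertonDyer.BirchSwinnertonDyer.Theorems

/-! ## §1. The inert twist supply at `2` (Murty–Murty) -/

section Supply

/-- **THE INERT TWIST SUPPLY AT `2` (PROVED modulo Murty–Murty 1997, Ch. 6).** For every elliptic
`W/ℚ` there is a quadratic field `K` with `2` INERT in `K` (`AddTwoL2.TwoInert K`: `d_K ≡ 5 (mod 8)`)
and `L(W^{(d_K)}, 1) ≠ 0` — input (b₅) `AddTwoL2.ExistsNonvanishingTwistWith W TwoInert` of the odd-core
doors L2-odd / L2-odd′ of MEMO-1 and the binder `hTw5` of `Theorems.additiveDefectAtTwo_of_inertPair`.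
Construction in the module docstring: Murty–Murty's squarefree `D ≡ 5 (mod 8)` with
`L(W^{(D)}, 1) ≠ 0` is a fundamental discriminant `≠ 1`, `K = ℚ(√D)`, `d_K = D`.
[cite: MurtyMurty1997, Ch. 6 Thm. 1.2 with the deduction of Thm. 1.1 (pp. 93–94, 96 of the text)] -/
theorem existsNonvanishingInertTwist_of_murtyMurty
    (hMM : murtyMurty_exists_twist_ne_zero_prescribedAtTwo) (W : WeierstrassCurve ℚ) [W.IsElliptic] :
    ExistsNonvanishingTwistWith W (fun K _ _ => TwoInert K) := by
  obtain ⟨D, -, hsq, h8, -, hL⟩ := hMM W 5 (Or.inr rfl) 0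
  have hD : (D % 4 = 1 ∧ Squarefree D ∧ D ≠ 1) ∨
      (4 ∣ D ∧ (D / 4 % 4 = 2 ∨ D / 4 % 4 = 3) ∧ Squarefree (D / 4)) :=
    Or.inl ⟨by omega, hsq, by omega⟩
  obtain ⟨K, _, _, h2, hdisc⟩ := Quadratic.exists_numberField_discr_eq hD
  refine ⟨K, inferInstance, inferInstance, h2, ?_, ?_⟩
  · show NumberField.discr K % 8 = 5
    rw [hdisc]
    exact h8
  · rw [hdisc]
    exact hL

/-- **The ∀-closed restatement in the binder shape `hTw5` of `Theorems.additiveDefectAtTwo_of_inertPair`**,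
discharged on the whole defect-`≥ 3` sub-class from Murty–Murty alone (the non-CM / rank / defect
hypotheses are not used). [cite: MurtyMurty1997, Ch. 6 Thm. 1.2 with the deduction of Thm. 1.1 (pp. 93–94, 96 of the text)] -/
theorem additiveInertTwistSupplyAtTwo_of_murtyMurty
    (hMM : murtyMurty_exists_twist_ne_zero_prescribedAtTwo) :
    ∀ (W : WeierstrassCurve ℚ) [W.IsElliptic] [W.IsGloballyMinimal],
      ¬ W.HasCM → W.analyticRank = 0 → DefectAtLeastThree W →
      ExistsNonvanishingTwistWith W (fun K _ _ => TwoInert K) :=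
  fun W _ _ _ _ _ => existsNonvanishingInertTwist_of_murtyMurty hMM W

end Supply

/-! ## §2. The inert pair door with the twist supply fed by name -/

section Door

/-- **The defect-`≥ 3` sub-class through the INERT pair door, twist supply DISCHARGED.** This is
`Theorems.additiveDefectAtTwo_of_inertPair` (seat `bsd-2adic-addL2`, GEN 4) with its binder `hTw5` fed by
`additiveInertTwistSupplyAtTwo_of_murtyMurty`: PRINT {Gross–Zagier–Kolyvagin `hGZK`, modularity `hmod`,
Milne 1972 `hMilne`, Murty–Murty 1997 `hMM`} + the lens-L1 UPPER halves at the additive prime (`hU`: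
`ord₂ #Ш ≤ ord₂ #Ш_an` for every non-CM analytic-rank-`0` additive-at-`2` curve — Kato's divisibility
with the local index at `2`, printed `p ≠ 2`; DISPLAYED) + the over-`K` `2`-part for the inert field
(`hGodd`: a globally minimal `K`-model `W'` of `W_K` with `MissingPPartOverAt W' 2` — BSD₂ over the inert
`K` for a curve ADDITIVE (potentially supersingular) at `(2)`, the `Δ = C₃`-equivariant descent object of
the odd core; on the 2-power core no descent group of order prime to `2` exists: WALL; DISPLAYED) ⟹
BSD₂ for every non-CM analytic-rank-`0` `W` with `AddTwoL2.DefectAtLeastThree W` (1 382 book230 classes).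
[cite: MurtyMurty1997, Ch. 6 Thm. 1.2 with the deduction of Thm. 1.1 (pp. 93–94, 96 of the text)]
[cite: Milne1972ArithmeticAV, §1 Thm. 1 (through DokchitserDokchitserAnnals2010 §2.1)] -/
theorem additiveDefectAtTwo_of_inertPair_of_murtyMurty
    (hGZK : rank_eq_analyticRank_of_analyticRank_le_one) (hmod : hasEntireLFunction_rat)
    (hMilne : Milne1972.bsdQuotient_baseChange_quadratic)
    (hMM : murtyMurty_exists_twist_ne_zero_prescribedAtTwo)
    (hU : ∀ (W : WeierstrassCurve ℚ) [W.IsElliptic] [W.IsGloballyMinimal],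
      ¬ W.HasCM → W.analyticRank = 0 → Addv W 2 → MissingUpperBoundAt W 2)
    (hGodd : ∀ (W : WeierstrassCurve ℚ) [W.IsElliptic] [W.IsGloballyMinimal],
      ¬ W.HasCM → W.analyticRank = 0 → DefectAtLeastThree W →
      ∀ (K : Type) [Field K] [NumberField K], Module.finrank ℚ K = 2 → TwoInert K →
        (W.quadraticTwist (NumberField.discr K : ℚ)).entireLFunction 1 ≠ 0 →
        ∃ (W' : WeierstrassCurve K) (_ : W'.IsElliptic) (_ : W'.IsGloballyMinimal),
          (∃ C : VariableChange K, C • W.baseChange K = W') ∧ MissingPPartOverAt W' 2)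
    (W : WeierstrassCurve ℚ) [W.IsElliptic] [W.IsGloballyMinimal] (hcm : ¬ W.HasCM)
    (hr : W.analyticRank = 0) (hdef : DefectAtLeastThree W) : BSDp W 2 :=
  additiveDefectAtTwo_of_inertPair hGZK hmod hMilne (additiveInertTwistSupplyAtTwo_of_murtyMurty hMM)
    hU hGodd W hcm hr hdef

/-- **The crux BY NAME from its quadratic part and the inert pair door with the twist supply fed.**
`AdditiveRankZeroAtTwo` follows from: BSD₂ ∀-closed on the quadratic sub-class (`hQ`, the line
`add_twist_overK`'s three non-wall stubs; NOT worked here) + PRINT {GZK, modularity, Milne 1972,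
Murty–Murty 1997} + `hU` + `hGodd` (DISPLAYED, see `additiveDefectAtTwo_of_inertPair_of_murtyMurty`),
by the exact sub-partition glue `Theorems.additiveRankZeroAtTwo_of_quadratic_of_defect`. Honest label:
`hU` and `hGodd` are research objects at `p = 2` (no print); this theorem only removes `hTw5` from the
list of displayed ∀-inputs of the defect-`≥ 3` sub-class.
[cite: MurtyMurty1997, Ch. 6 Thm. 1.2 with the deduction of Thm. 1.1 (pp. 93–94, 96 of the text)] -/
theorem additiveRankZeroAtTwo_of_quadratic_of_inertPair_of_murtyMurty
    (hQ : ∀ (W : WeierstrassCurve ℚ) [W.IsElliptic] [W.IsGloballyMinimal],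
      ¬ W.HasCM → W.analyticRank = 0 → Addv W 2 → QuadSemistabilisable W → BSDp W 2)
    (hGZK : rank_eq_analyticRank_of_analyticRank_le_one) (hmod : hasEntireLFunction_rat)
    (hMilne : Milne1972.bsdQuotient_baseChange_quadratic)
    (hMM : murtyMurty_exists_twist_ne_zero_prescribedAtTwo)
    (hU : ∀ (W : WeierstrassCurve ℚ) [W.IsElliptic] [W.IsGloballyMinimal],
      ¬ W.HasCM → W.analyticRank = 0 → Addv W 2 → MissingUpperBoundAt W 2)
    (hGodd : ∀ (W : WeierstrassCurve ℚ) [W.IsElliptic] [W.IsGloballyMinimal],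
      ¬ W.HasCM → W.analyticRank = 0 → DefectAtLeastThree W →
      ∀ (K : Type) [Field K] [NumberField K], Module.finrank ℚ K = 2 → TwoInert K →
        (W.quadraticTwist (NumberField.discr K : ℚ)).entireLFunction 1 ≠ 0 →
        ∃ (W' : WeierstrassCurve K) (_ : W'.IsElliptic) (_ : W'.IsGloballyMinimal),
          (∃ C : VariableChange K, C • W.baseChange K = W') ∧ MissingPPartOverAt W' 2) :
    Summit.BirchSwinnertonDyer.BirchSwinnertonDyer.Theses.ByReductionTypeAtTwo.AdditiveRankZeroAtTwo :=
  additiveRankZeroAtTwo_of_quadratic_of_defect hQ fun W _ _ hcm hr hdef =>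
    additiveDefectAtTwo_of_inertPair_of_murtyMurty hGZK hmod hMilne hMM hU hGodd W hcm hr hdef

end Door

end Summit.BirchSwinnertonDyer.BirchSwinnertonDyer.Theorems

end
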